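import Summits.BirchSwinnertonDyer.Rank1Residual.X11b.Three.ImageAtThreeField
import Summits.BirchSwinnertonDyer.Rank1Residual.X11b.Three.ImageAtThreeNormal
import Summits.BirchSwinnertonDyer.Rank1Residual.X11b.Three.GaloisImageNegOne
import Literature.FieldTheory.Galois.NormalClosureDegree
import Literature.NumberTheory.GaloisRepresentations.ArtinRestriction
import HarnessLib

/-!
# Route `ClassRecordThree` ∕ `KolyvaginRoadThree` (cell `bsd-stepL`), crux 19109 `EulerHalvesAtThree`,
# the UB road at `p = 3` (PROOF-BDP §48.1): `ρ̄_{E,3}|_{G_F}` is onto `Aut(E[3])` for EVERY number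
# field `F` NORMAL over `ℚ` containing no primitive cube root of unity — and then `E[3^m]^{G_F} = 0`
# and `H¹(F(E[3^m])∕F, E[3^m]) = 0` for every `m ≥ 1`

Seat `bsd-stepL-bdp` g20 (prover), 2026-08-27; `--supports stmt-BirchSwinnertonDyer-19109 --as helper`.

WHY. PROOF-BDP §48.1 reads Howard, Compos. Math. 140 (2004) at `p = 3`: Howard's standing hypothesis
«`Gal(K̄∕K) → Aut_{ℤ_p}(T_pE)` surjective» is used at four places only, each of the shape
(i) `ρ̄_{E,3}(G_F) = Aut(E[3])`, (ii) `−1 ∈ ρ_{E,3^m}(G_F)`, (iii) `E[3^m]^{G_F} = 0`,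
(ii′) `H¹(F(E[3^m])∕F, E[3^m]) = 0`, for the fields `F ∈ {K, K_∞-layers K_k, ring class composita
K_k[n]}` — all NORMAL over `ℚ` (generalised dihedral) and none containing `√−3` when `3 ∤ n·d_K`
(§48.1 Lemma A: `K[n]∕K` is unramified outside `n`, `K(√−3)∕K` ramifies at `3`). The x11b3 ∕ koly
lineages proved the pieces: `GL2F3.le_ker_det_of_normal_of_ne_top` (`ImageAtThreeNormal`: every proper
normal subgroup of `GL₂(𝔽₃)` lies in `SL₂(𝔽₃)`), the quadratic-`K` corollary
`surjective_galoisRepTorsion_comp_absGaloisRestrict_of_not_dvd_discr` (`ImageAtThreeField`, via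
INDEX TWO), and the `−1`-lift ∕ Sah lemmas (`GaloisImageNegOne`, `TorsionNegOneLift`). THIS FILE
assembles the general NORMAL-`F` form, which is what Howard's fields need (they are not quadratic):

* `normal_range_absGaloisRestrict` — for `F∕ℚ` normal, `res(Γ_F) = Gal(ℚ̄∕e(F))` is a NORMAL subgroup
  of `Γ_ℚ` (all embeddings of a normal `F` into `ℚ̄` have the same image).
* `exists_sq_add_self_add_one_eq_zero_of_range_le_ker_cyclotomic` — if `res(Γ_F) ≤ ker χ₃` then `F`
  contains a primitive cube root of unity (infinite Galois correspondence,
  `Rat.exists_eq_of_forall_range_absGaloisRestrict_smul`).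
* `map_galoisRepTorsion_eq_top_of_normal` — for `ρ̄_{E,3}` onto and `Γ' ⊴ Γ_ℚ` NOT contained in
  `ker χ₃`: `ρ̄_{E,3}(Γ') = Aut(E[3])` (`ρ̄(Γ')` is normal in `Aut(E[3]) ≅ GL₂(𝔽₃)`; if proper it lies
  in `ker(det ∘ Φ)`, i.e. `Γ' ≤ ker χ₃` by the Weil pairing `det ∘ Φ ∘ ρ̄ = χ₃`).
* **`surjective_galoisRepTorsion_comp_absGaloisRestrict_of_normal`** — `E∕ℚ` with `ρ̄_{E,3}` onto,
  `F∕ℚ` a normal number field with no `x`, `x² + x + 1 = 0`: `ρ̄_{E,3} ∘ (Γ_F → Γ_ℚ)` is onto.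
* `exists_absGaloisRestrict_smul_eq_neg_of_normal` — hence some `σ ∈ Γ_F` acts as `−1` on `E[3]`;
  `geomTorsion_pow_eq_zero_of_forall_absGaloisRestrict_smul_eq` — (iii) `E[3^m]` has no non-zero
  point fixed by `Γ_F`, every `m ≥ 1`; `neg_mem_range_galoisRepTorsion_comp_absGaloisRestrict` — (ii);
  `galoisImage_comp_absGaloisRestrict_crossedHom_principal` — (ii′) every crossed homomorphism of
  the image group `(ρ_{E,3^m} ∘ res)(Γ_F) ≅ Gal(F(E[3^m])∕F)` with values in `E[3^m]` is principal.

HONEST FRAMING: elementary Galois ∕ group theory; theorems only (0 defs, 0 facts, 0 `sorry`); a HELPER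
for the memo-level (ε3a)@3 step of PROOF-BDP §48 (Howard's Kolyvagin-system hypotheses H.1∕H.2 and
`E(K_k[n])[3] = 0` at `p = 3` from `Surj W 3` alone) — it does NOT prove Lemma A (`√−3 ∉ K_∞K[n]`,
class field theory, left to the consumer as the hypothesis `hF`), does not touch any item's statement,
closes nothing; no census number, label or tier moves (T7); BSD proved for no curve.

References: B. Howard, Compos. Math. 140 (2004) §2.3 H.1–H.2, §2.6, §3.1 [Howard2004]; C.-H. Sah,
J. Algebra 10 (1968) Prop. 2.7 (b) [Sah1968]; T. Lawson, C. Wuthrich, Springer PROMS 188 (2016)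
Lemma 3 [LawsonWuthrich2016]; J.-P. Serre, Invent. Math. 15 (1972) §2 [Serre1972]; cell memo
HOME/proof/PROOF-BDP.md §48.1.
-/

set_option linter.dupNamespace false

noncomputable section

open scoped Classical

open WeierstrassCurve Field Module NumberField
  Literature.NumberTheory.EllipticCurves Literature.NumberTheory.EllipticCurves.Rank1Residual
  Literature.NumberTheory.GaloisRepresentations Literature.FieldTheory.Galois
  Summit.BirchSwinnertonDyer.Rank1Residual.X11b.Three

namespace Summit.BirchSwinnertonDyer.BirchSwinnertonDyer.Theorems.ImageAtThreeNormalField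

/-! ### §1 Normal number fields: the range of restriction is normal; the cube-root criterion -/

section NormalField

variable (F : Type) [Field F] [NumberField F]

/-- **For `F∕ℚ` normal, `res(Γ_F) ≤ Γ_ℚ` is a normal subgroup.** `res(Γ_F)` is the pointwise
stabiliser of `e(F)` for some embedding `e : F → ℚ̄` (`exists_mem_range_absGaloisRestrict_iff`); for
`g ∈ Γ_ℚ`, `g⁻¹ ∘ e` is another embedding of the NORMAL field `F`, hence has the same image
(`normalClosure_eq_fieldRange_of_normal`), so `g n g⁻¹` fixes `e(F)` whenever `n` does.
[folklore] -/
theorem normal_range_absGaloisRestrict [Normal ℚ F] :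
    ((absGaloisRestrict ℚ F).range : Subgroup (absoluteGaloisGroup ℚ)).Normal := by
  obtain ⟨e, he⟩ := exists_mem_range_absGaloisRestrict_iff ℚ F
  refine ⟨fun n hn g => ?_⟩
  rw [he] at hn ⊢
  intro x
  -- `g⁻¹ • e x = e y` for some `y : F` (normality of `F`)
  -- NB: no type ascription on `e'` (keep the `ℚ`-algebra instance on `ℚ̄` carried by `e`)
  set e' := (absoluteGaloisGroup.toAlgEquiv ℚ g⁻¹).toAlgHom.comp e with he'
  have hrange : e'.fieldRange = e.fieldRange :=
    (normalClosure_eq_fieldRange_of_normal e').symm.trans (normalClosure_eq_fieldRange_of_normal e)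
  have hx : e' x ∈ e.fieldRange := by
    rw [← hrange]
    exact ⟨x, rfl⟩
  obtain ⟨y, hy⟩ := AlgHom.mem_fieldRange.mp hx
  have hgx : g⁻¹ • e x = e y := by
    rw [hy, he', AlgHom.comp_apply, absoluteGaloisGroup.smul_def]
    rfl
  rw [mul_smul, mul_smul, hgx, hn y, ← hgx, smul_inv_smul]

/-- **If `res(Γ_F) ≤ ker χ₃` then `F` contains a primitive cube root of unity.** A primitive cube root
of unity `ζ ∈ ℚ̄` is fixed by `ker χ₃ ⊇ res(Γ_F)`, hence lies in `e(F)` by the infinite Galois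
correspondence (`Rat.exists_eq_of_forall_range_absGaloisRestrict_smul`), and `ζ² + ζ + 1 = 0`
transports to `F`. (The quadratic case with the discriminant conclusion is
`Three.discr_eq_neg_three_of_range_le_ker_cyclotomic`.) [folklore] -/
theorem exists_sq_add_self_add_one_eq_zero_of_range_le_ker_cyclotomic
    (hle : ((absGaloisRestrict ℚ F).range : Subgroup (absoluteGaloisGroup ℚ)) ≤
      (modPCyclotomicCharacterZMod ℚ 3).ker) :
    ∃ x : F, x ^ 2 + x + 1 = 0 := by
  haveI : NeZero ((3 : ℕ) : ℚ) := ⟨by norm_num⟩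
  haveI : Fact (1 < 3) := ⟨by norm_num⟩
  obtain ⟨ζ, hζp⟩ := HasEnoughRootsOfUnity.exists_primitiveRoot (AlgebraicClosure ℚ) 3
  have hζ3 : ζ ^ 3 = 1 := hζp.pow_eq_one
  have hζ : ζ ^ 2 + ζ + 1 = 0 := by
    have h := hζp.geom_sum_eq_zero (by norm_num : 1 < 3)
    rw [Finset.sum_range_succ, Finset.sum_range_succ, Finset.sum_range_succ,
      Finset.sum_range_zero] at h
    linear_combination h
  have hfix : ∀ τ ∈ ((absGaloisRestrict ℚ F).range : Subgroup (absoluteGaloisGroup ℚ)),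
      τ • ζ = ζ := by
    intro τ hτ
    have h1 : modPCyclotomicCharacterZMod ℚ 3 τ = 1 := hle hτ
    rw [modPCyclotomicCharacterZMod_spec ℚ 3 τ ζ hζ3, h1, Units.val_one, ZMod.val_one, pow_one]
  obtain ⟨e, x, hx⟩ := Rat.exists_eq_of_forall_range_absGaloisRestrict_smul F hfix
  refine ⟨x, ?_⟩
  apply e.toRingHom.injective
  rw [map_zero, map_add, map_add, map_pow, map_one]
  change e x ^ 2 + e x + 1 = 0
  rw [hx, hζ]

end NormalField

/-! ### §2 `Γ_ℚ`-level: a normal subgroup not inside `ker χ₃` maps onto `Aut(E[3])` -/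

section Rational

variable (W : WeierstrassCurve ℚ) [W.IsElliptic]

/-- **For `ρ̄_{E,3}` onto, every NORMAL subgroup `Γ' ⊴ Γ_ℚ` not contained in `ker χ₃ = Gal(ℚ̄∕ℚ(√−3))`
maps ONTO `Aut(E[3])`.** The image `ρ̄(Γ')` is normal in `Aut(E[3]) ≅ GL₂(𝔽₃)` (frame `Φ` with
`det ∘ Φ ∘ ρ̄ = χ₃`, tree theorem `exists_frame_galoisRepTorsion_rat`); a PROPER normal subgroup of
`GL₂(𝔽₃)` lies in `SL₂(𝔽₃)` (`GL2F3.le_ker_det_of_normal_of_ne_top`), which would put `Γ'` inside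
`ker(det ∘ Φ ∘ ρ̄) = ker χ₃`. [folklore] -/
theorem map_galoisRepTorsion_eq_top_of_normal (hsurj : W.HasSurjectiveModNGaloisRep (3 : ℕ))
    (Γ' : Subgroup (absoluteGaloisGroup ℚ)) [hN : Γ'.Normal]
    (hnot : ¬ Γ' ≤ (modPCyclotomicCharacterZMod ℚ 3).ker) :
    Γ'.map (galoisRepTorsion W (3 : ℕ)) = ⊤ := by
  obtain ⟨_, Φ, -, -, hdet, -, -⟩ := exists_frame_galoisRepTorsion_rat W 3
  set ρ := galoisRepTorsion W (3 : ℕ) with hρ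
  by_contra hne
  haveI hN1 : (Γ'.map ρ).Normal := Subgroup.Normal.map hN ρ hsurj
  haveI hN2 : ((Γ'.map ρ).map Φ.toMonoidHom).Normal :=
    Subgroup.Normal.map hN1 Φ.toMonoidHom Φ.surjective
  have hne' : (Γ'.map ρ).map Φ.toMonoidHom ≠ ⊤ := by
    intro h
    apply hne
    have h' := congrArg (Subgroup.comap Φ.toMonoidHom) h
    rwa [Subgroup.comap_map_eq_self_of_injective Φ.injective, Subgroup.comap_top] at h'
  have hle := GL2F3.le_ker_det_of_normal_of_ne_top ((Γ'.map ρ).map Φ.toMonoidHom) hne'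
  apply hnot
  intro σ hσ
  have h1 : Φ (ρ σ) ∈ (Matrix.GeneralLinearGroup.det : GL (Fin 2) (ZMod 3) →* (ZMod 3)ˣ).ker :=
    hle ⟨ρ σ, ⟨σ, hσ, rfl⟩, rfl⟩
  rw [hρ] at h1
  rw [← ker_det_comp_frame_eq_ker_cyclotomic W Φ hdet, MonoidHom.mem_ker, MonoidHom.comp_apply,
    MonoidHom.comp_apply, MulEquiv.coe_toMonoidHom]
  exact (MonoidHom.mem_ker).mp h1

end Rational

/-! ### §3 The field corollaries: normal `F` without primitive cube roots of unity -/

section Corollary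

variable (W : WeierstrassCurve ℚ) [W.IsElliptic] (F : Type) [Field F] [NumberField F]

/-- **`ρ̄_{E,3}|_{G_F}` is onto `Aut(E[3])`** for `E∕ℚ` with `ρ̄_{E,3}` onto and `F∕ℚ` a NORMAL number
field containing no primitive cube root of unity (no `x ∈ F` with `x² + x + 1 = 0`) — e.g. every
ring class field `K[n]` of an imaginary quadratic `K` with `3 ∤ n·d_K`, every layer of the
anticyclotomic `ℤ₃`-extension of such a `K`, and their composita (PROOF-BDP §48.1 Lemma A). The
quadratic case is `Three.surjective_galoisRepTorsion_comp_absGaloisRestrict_of_not_dvd_discr`.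
[cite: Howard2004, §2.6 proof of Thm. 2.6.5 and §3.1 Prop. 3.1.3 (hypotheses H.1–H.2; arXiv:1202.6340 pp. 12, 15)] -/
theorem surjective_galoisRepTorsion_comp_absGaloisRestrict_of_normal [Normal ℚ F]
    (hsurj : W.HasSurjectiveModNGaloisRep (3 : ℕ)) (hF : ∀ x : F, x ^ 2 + x + 1 ≠ 0) :
    Function.Surjective ((galoisRepTorsion W (3 : ℕ)).comp
      (absGaloisRestrict ℚ F : absoluteGaloisGroup F →* absoluteGaloisGroup ℚ)) := by
  haveI := normal_range_absGaloisRestrict F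
  have hnot : ¬ ((absGaloisRestrict ℚ F).range : Subgroup (absoluteGaloisGroup ℚ)) ≤
      (modPCyclotomicCharacterZMod ℚ 3).ker := by
    intro hle
    obtain ⟨x, hx⟩ := exists_sq_add_self_add_one_eq_zero_of_range_le_ker_cyclotomic F hle
    exact hF x hx
  have htop := map_galoisRepTorsion_eq_top_of_normal W hsurj _ hnot
  rw [← MonoidHom.range_eq_top, ← MonoidHom.map_range]
  exact htop

/-- **Some `σ ∈ Γ_F` acts as `−1` on `E[3]`** (under the hypotheses of
`surjective_galoisRepTorsion_comp_absGaloisRestrict_of_normal`): the negation automorphism of `E[3]`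
has a preimage. [cite: LawsonWuthrich2016, Lemma 3] -/
theorem exists_absGaloisRestrict_smul_eq_neg_of_normal [Normal ℚ F]
    (hsurj : W.HasSurjectiveModNGaloisRep (3 : ℕ)) (hF : ∀ x : F, x ^ 2 + x + 1 ≠ 0) :
    ∃ σ : absoluteGaloisGroup F,
      ∀ P : W.geomTorsion ((3 : ℕ) : ℤ), absGaloisRestrict ℚ F σ • P = -P := by
  obtain ⟨σ, hσ⟩ := surjective_galoisRepTorsion_comp_absGaloisRestrict_of_normal W F hsurj hF
    (Multiplicative.ofAdd (AddEquiv.neg (W.geomTorsion ((3 : ℕ) : ℤ))))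
  refine ⟨σ, fun P ↦ ?_⟩
  have h := hσ
  rw [MonoidHom.comp_apply] at h
  change galoisRepTorsion W ((3 : ℕ) : ℤ) (absGaloisRestrict ℚ F σ) = _ at h
  rw [← galoisRepTorsion_apply, h]
  rfl

/-- **(iii) `E[3^m]^{G_F} = 0`**: for `m ≥ 1`, a point of `E[3^m]` fixed by (the image in `Γ_ℚ` of) every
element of `Γ_F` is `0` — with `σ₀` acting as `−1` on `E[3]`, `σ₀^{3^{m−1}}` acts as `−1` on `E[3^m]`
(`Three.smul_pow_three_pow_eq_neg`, Lawson–Wuthrich's lift), so a fixed `x` satisfies `x = −x`, and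
`2` is injective on a `3^m`-torsion group. Howard's «E(K[n])[p] = 0», «E(K_∞)[p] = 0» at `p = 3`.
[cite: Howard2004, §2.7 (before Lemma 2.7.2) and §3.2 Lemma 3.2.9 (arXiv:1202.6340 pp. 13, 17)] -/
theorem geomTorsion_pow_eq_zero_of_forall_absGaloisRestrict_smul_eq [Normal ℚ F]
    (hsurj : W.HasSurjectiveModNGaloisRep (3 : ℕ)) (hF : ∀ x : F, x ^ 2 + x + 1 ≠ 0) {m : ℕ}
    (hm : 1 ≤ m) {x : W.geomTorsion ((3 ^ m : ℕ) : ℤ)}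
    (hfix : ∀ σ : absoluteGaloisGroup F, absGaloisRestrict ℚ F σ • x = x) : x = 0 := by
  obtain ⟨σ₀, hσ₀⟩ := exists_absGaloisRestrict_smul_eq_neg_of_normal W F hsurj hF
  have hneg := smul_pow_three_pow_eq_neg hm (W.nsmul_eq_zero_geomTorsion_pow m)
    (fun y hy ↦ W.smul_eq_neg_geomTorsion_pow_of_three_nsmul hσ₀ m y hy) x
  rw [← map_pow, hfix] at hneg
  have h2 : (2 : ℕ) • x = 0 := by rw [two_nsmul]; nth_rw 2 [hneg]; exact add_neg_cancel x
  exact TorsionLift.eq_zero_of_two_nsmul_eq_zero_of_odd_nsmul_eq_zero (Odd.pow (by decide))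
    (W.nsmul_eq_zero_geomTorsion_pow m x) h2

/-- **(ii) `−1 ∈ (ρ_{E,3^m} ∘ res)(Γ_F)`** for every `m ≥ 1`. [cite: LawsonWuthrich2016, Lemma 3] -/
theorem neg_mem_range_galoisRepTorsion_comp_absGaloisRestrict [Normal ℚ F]
    (hsurj : W.HasSurjectiveModNGaloisRep (3 : ℕ)) (hF : ∀ x : F, x ^ 2 + x + 1 ≠ 0) {m : ℕ}
    (hm : 1 ≤ m) :
    Multiplicative.ofAdd (AddEquiv.neg (W.geomTorsion ((3 ^ m : ℕ) : ℤ))) ∈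
      ((W.galoisRepTorsion ((3 ^ m : ℕ) : ℤ)).comp
        (absGaloisRestrict ℚ F : absoluteGaloisGroup F →* absoluteGaloisGroup ℚ)).range := by
  obtain ⟨σ₀, hσ₀⟩ := exists_absGaloisRestrict_smul_eq_neg_of_normal W F hsurj hF
  refine ⟨σ₀ ^ 3 ^ (m - 1), ?_⟩
  have hneg := smul_pow_three_pow_eq_neg hm (W.nsmul_eq_zero_geomTorsion_pow m)
    (fun y hy ↦ W.smul_eq_neg_geomTorsion_pow_of_three_nsmul hσ₀ m y hy)
  apply Multiplicative.toAdd.injective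
  apply AddEquiv.ext
  intro x
  rw [MonoidHom.comp_apply]
  change Multiplicative.toAdd (galoisRepTorsion W ((3 ^ m : ℕ) : ℤ)
    (absGaloisRestrict ℚ F (σ₀ ^ 3 ^ (m - 1)))) x = -x
  rw [map_pow, galoisRepTorsion_apply, hneg]

/-- **(ii′) `H¹(F(E[3^m])∕F, E[3^m]) = 0`** for every `m ≥ 1`: every crossed homomorphism of the image
group `(ρ_{E,3^m} ∘ res)(Γ_F) ≤ Aut(E[3^m])` (≅ `Gal(F(E[3^m])∕F)`) with values in `E[3^m]` is
principal — Sah's lemma with the central element `−1` (`Three.exists_eq_sub_of_crossedHom_of_neg_mem`).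
Howard's hypothesis H.2 at `p = 3` over the fields `F` of §48.1.
[cite: Sah1968, Prop. 2.7 (b) and its proof, p. 60] [cite: Howard2004, §2.3 H.2 and §2.6 (arXiv:1202.6340 pp. 7, 12)] -/
theorem galoisImage_comp_absGaloisRestrict_crossedHom_principal [Normal ℚ F]
    (hsurj : W.HasSurjectiveModNGaloisRep (3 : ℕ)) (hF : ∀ x : F, x ^ 2 + x + 1 ≠ 0) {m : ℕ}
    (hm : 1 ≤ m)
    (f : ((W.galoisRepTorsion ((3 ^ m : ℕ) : ℤ)).comp
        (absGaloisRestrict ℚ F : absoluteGaloisGroup F →* absoluteGaloisGroup ℚ)).range →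
      W.geomTorsion ((3 ^ m : ℕ) : ℤ))
    (hf : ∀ g h : ((W.galoisRepTorsion ((3 ^ m : ℕ) : ℤ)).comp
        (absGaloisRestrict ℚ F : absoluteGaloisGroup F →* absoluteGaloisGroup ℚ)).range,
      f (g * h) =
        Multiplicative.toAdd (g : Multiplicative (AddAut (W.geomTorsion ((3 ^ m : ℕ) : ℤ))))
          (f h) + f g) :
    ∃ a : W.geomTorsion ((3 ^ m : ℕ) : ℤ),
      ∀ g : ((W.galoisRepTorsion ((3 ^ m : ℕ) : ℤ)).comp
        (absGaloisRestrict ℚ F : absoluteGaloisGroup F →* absoluteGaloisGroup ℚ)).range,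
      f g = Multiplicative.toAdd (g : Multiplicative (AddAut (W.geomTorsion ((3 ^ m : ℕ) : ℤ)))) a
        - a :=
  exists_eq_sub_of_crossedHom_of_neg_mem (Odd.pow (by decide) : Odd (3 ^ m))
    (W.nsmul_eq_zero_geomTorsion_pow m) _
    (neg_mem_range_galoisRepTorsion_comp_absGaloisRestrict W F hsurj hF hm) (fun _ ↦ rfl) f hf

end Corollary

end Summit.BirchSwinnertonDyer.BirchSwinnertonDyer.Theorems.ImageAtThreeNormalField

end
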